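import Mathlib.GroupTheory.Index
import Mathlib.GroupTheory.Subgroup.Center
import Mathlib.Analysis.SpecialFunctions.Pow.Real
import Literature.Combinatorics.Additive.TripleProductProperty
import HarnessLib

/-!
# Barrier: subgroups that are far from self-normalizing cannot meet the packing bound (Blasiak–Cohn–Grochow–Pratt–Umans 2023) — proved

Topic `Literature/Barriers/MatrixMultiplication` (D-0021 barrier catalogue for the summit
`MatrixMultiplication`, `ω(ℂ) = 2`; group-theoretic approach of Cohn–Umans, non-abelian line —
cf. the route item `CNonabelianTPPFamilies` of `MatrixMultiplication/GroupTheoreticSTPP`, which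
names this paper's §3 as what candidate families "must evade").

Source: J. Blasiak, H. Cohn, J. A. Grochow, K. Pratt, C. Umans, *Matrix multiplication via matrix
groups*, ITCS 2023, LIPIcs 251, 19:1–19:16, arXiv:2204.03826 (held copy `paper:arxiv-2204.03826`,
read with `lit read`: §2 with Def. 2.1, Thm. 2.2, Def. 2.3 (packing bound) and the paragraph
"Meeting the packing bound is a necessary condition …" (p. 5 of the held text); §3.2 with Thm. 3.6
and its proof, Rem. 3.7, Cor. 3.8 and its proof (p. 7)). Everything in this file is PROVED.

## Catalogue entry

The D-0021 structured block is in the docstring of the catalogue declaration `NormalizerBarrier`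
at the end of this file.

## Content

* `SubgroupTPP H₁ H₂ H₃` — the triple product property for three subgroups (Cohn–Umans 2003,
  Def. 2.1 = BCGPU Def. 2.1 with `Q(H) = H`), with `subgroupTPP_iff_tripleProductProperty` (it is
  the tree's `TripleProductProperty` of the three finite sets) and cyclic symmetry `rotate`.
* `card_mul_card_le_card_inf_mul_card` (`|H||K| ≤ |H ∩ K||G|`), `card_mul_card_center_le`
  (`|H||Z(G)| ≤ |N(H)||H ∩ Z(G)|`).
* **Thm. 3.6** (`SubgroupTPP.normalizer_barrier_nat`, `SubgroupTPP.normalizer_barrier`):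
  `(|H₁||H₂||H₃|)³ |N(H₁)||N(H₂)||N(H₃)| ≤ |G|⁶`, i.e. `|H₁||H₂||H₃| ≤ |G|^{3/2}/(s₁s₂s₃)^{1/4}`,
  `sᵢ = |N(Hᵢ)|/|Hᵢ|`, via the printed injectivity of `(h₁,h₂,h₃) ↦ h₁h₂h₃` on
  `H₁ × (N(H₁) ∩ H₂) × H₃` (`card_mul_card_normalizer_inf_mul_card_le`).
* **Cor. 3.8** (`SubgroupTPP.center_barrier_nat`, `SubgroupTPP.center_barrier`):
  `(|H₁||H₂||H₃|)² |Z(G)| ≤ |G|³`, i.e. `|H₁||H₂||H₃| ≤ |G|^{3/2}/|Z(G)|^{1/2}`, via the abelian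
  bound `|H₁ ∩ Z||H₂ ∩ Z||H₃ ∩ Z| ≤ |Z|` (`prod_card_inf_center_le`, Cohn–Umans 2003 Lemma 3.1 inside
  `Z(G)`).
* `SubgroupTPP.center_barrier_rpow` — the packing-bound reading: `|Z(G)| ≥ |G|^δ` forces
  `|H₁||H₂||H₃| ≤ |G|^{3/2 − δ/2}`.
* Catalogue entry `NormalizerBarrier : Prop` (Thm. 3.6 ∧ Cor. 3.8 in integral form, universally
  quantified over finite groups in `Type`), PROVED (`normalizerBarrier_holds`).
* `tpp_card_mul_card_mul_card_coset_center_le` — what survives of the centre step for arbitrary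
  finite SUBSETS `S, T, U` with the tree's `TripleProductProperty`: only a single coset fibre of `U`
  over `Z(G)` is charged, `|S| |T| |U ∩ Z(G)g| ≤ |G|` (barrier audit 2026-08-15; documents scope
  caveat (f) of the block: sets transverse to the centre escape Cor. 3.8).

## Design choices

* Cardinalities are `Nat.card` under `[Finite G]` (as in `CharacterDegrees.lean` /
  `CohnUmansTPP.lean`); the normaliser is Mathlib's `Subgroup.normalizer (H : Set G)`.
* The printed real-number forms are derived from exact integral inequalities, so no rounding or
  positivity side conditions beyond `|Hᵢ|, |G| ≥ 1` enter.
* Rem. 3.7 (arbitrary subsets `S, T, U`, with `N(Q(S)) ∩ T` etc.) is cited in the block and, since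
  2026-08-23, PROVED in the companion file `NormalizerBarrierSubsets.lean` (`BCGPU2023_rem37_sq`,
  `BCGPU2023_rem37`, `tpp_card_mul_card_normalizer_quot_mul_card_le`); this file is unchanged by it.
-/

noncomputable section

open scoped BigOperators

namespace Literature.Barriers.MatrixMultiplication

universe u

variable {G : Type u} [Group G]

/-! ## The triple product property for three subgroups -/

/-- **Triple product property for three subgroups** `H₁, H₂, H₃ ≤ G` (Cohn–Umans 2003, Def. 2.1,
in the subgroup case, where the quotient sets are the subgroups themselves: BCGPU 2023, §2, "The
simplest case is when the three subsets of `G` are subgroups, in which case we do not need to take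
their quotient sets since `Q(H) = H`"): `h₁ h₂ h₃ = 1` with `hᵢ ∈ Hᵢ` forces `h₁ = h₂ = h₃ = 1`.
Equivalent to the tree's `TripleProductProperty` of the three underlying finite sets
(`subgroupTPP_iff_tripleProductProperty`). [cite: BlasiakCohnGrochowPrattUmans2023, Def. 2.1] -/
def SubgroupTPP (H₁ H₂ H₃ : Subgroup G) : Prop :=
  ∀ a ∈ H₁, ∀ b ∈ H₂, ∀ c ∈ H₃, a * b * c = 1 → a = 1 ∧ b = 1 ∧ c = 1

variable {H₁ H₂ H₃ : Subgroup G}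

/-- The subgroup TPP is invariant under the cyclic shift `(H₁, H₂, H₃) ↦ (H₂, H₃, H₁)`
(`abc = 1 ⟺ bca = 1`). [folklore] -/
theorem SubgroupTPP.rotate (h : SubgroupTPP H₁ H₂ H₃) : SubgroupTPP H₂ H₃ H₁ := by
  intro b hb c hc a ha habc
  have h' : a * b * c = 1 := by
    have : a * (b * c * a) * a⁻¹ = 1 := by rw [habc, mul_one, mul_inv_cancel]
    simpa [mul_assoc] using this
  obtain ⟨ha1, hb1, hc1⟩ := h a ha b hb c hc h'
  exact ⟨hb1, hc1, ha1⟩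

/-- The subgroup TPP is literally the tree's `TripleProductProperty` (Cohn–Umans 2003, Def. 2.1,
with quotient sets `Q(S) = {s s'⁻¹}`) of the three underlying finite sets
`{g | g ∈ Hᵢ}`. [folklore] -/
theorem subgroupTPP_iff_tripleProductProperty [Fintype G] (H₁ H₂ H₃ : Subgroup G)
    [DecidablePred (· ∈ H₁)] [DecidablePred (· ∈ H₂)] [DecidablePred (· ∈ H₃)] :
    SubgroupTPP H₁ H₂ H₃ ↔ Literature.Combinatorics.Additive.TripleProductProperty
      (Finset.univ.filter (· ∈ H₁)) (Finset.univ.filter (· ∈ H₂))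
      (Finset.univ.filter (· ∈ H₃)) := by
  constructor
  · intro h s hs s' hs' t ht t' ht' u hu u' hu' he
    simp only [Finset.mem_filter, Finset.mem_univ, true_and] at hs hs' ht ht' hu hu'
    obtain ⟨h1, h2, h3⟩ := h _ (H₁.mul_mem hs (H₁.inv_mem hs')) _ (H₂.mul_mem ht (H₂.inv_mem ht'))
      _ (H₃.mul_mem hu (H₃.inv_mem hu')) he
    exact ⟨mul_inv_eq_one.1 h1, mul_inv_eq_one.1 h2, mul_inv_eq_one.1 h3⟩
  · intro h a ha b hb c hc he
    have mem : ∀ {H : Subgroup G} [DecidablePred (· ∈ H)] {g : G}, g ∈ H →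
        g ∈ Finset.univ.filter (· ∈ H) := fun hg => by simpa using hg
    exact h a (mem ha) 1 (mem H₁.one_mem) b (mem hb) 1 (mem H₂.one_mem) c (mem hc) 1
      (mem H₃.one_mem) (by simpa using he)

/-! ## The counting lemmas -/

section Counting

variable [Finite G]

/-- For subgroups `H, K` of a finite group, `|H| |K| ≤ |H ∩ K| |G|` (from
`[G : H ∩ K] ≤ [G : H][G : K]`, Mathlib `Subgroup.index_inf_le`; equality form `|HK| |H ∩ K| =
|H||K|` with `|HK| ≤ |G|`, as used in BCGPU 2023, proof of Thm. 3.6). [folklore] -/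
theorem card_mul_card_le_card_inf_mul_card (H K : Subgroup G) :
    Nat.card H * Nat.card K ≤ Nat.card ↥(H ⊓ K) * Nat.card G := by
  have hi : (H ⊓ K).index ≤ H.index * K.index := Subgroup.index_inf_le
  have e1 := (H ⊓ K).card_mul_index
  have e2 := H.card_mul_index
  have e3 := K.card_mul_index
  have hg : 0 < Nat.card G := Nat.card_pos
  refine Nat.le_of_mul_le_mul_left ?_ hg
  calc Nat.card G * (Nat.card H * Nat.card K)
      = (Nat.card ↥(H ⊓ K) * (H ⊓ K).index) * (Nat.card H * Nat.card K) := by rw [e1]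
    _ ≤ (Nat.card ↥(H ⊓ K) * (H.index * K.index)) * (Nat.card H * Nat.card K) := by gcongr
    _ = Nat.card ↥(H ⊓ K) * ((Nat.card H * H.index) * (Nat.card K * K.index)) := by ring
    _ = Nat.card G * (Nat.card ↥(H ⊓ K) * Nat.card G) := by rw [e2, e3]; ring

/-- **The main observation of BCGPU 2023, proof of Thm. 3.6**: if subgroups `H₁, H₂, H₃` satisfy the
triple product property, then `(h₁, h₂, h₃) ↦ h₁h₂h₃` is injective on
`H₁ × (N(H₁) ∩ H₂) × H₃`, so `|H₁| · |N(H₁) ∩ H₂| · |H₃| ≤ |G|` ("`h₂'⁻¹(h₁'⁻¹h₁)h₂'` is another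
element `h₁'' ∈ H₁` … since `h₂'` is in the normalizer of `H₁`").
[cite: BlasiakCohnGrochowPrattUmans2023, Thm. 3.6 (proof)] -/
theorem SubgroupTPP.card_mul_card_normalizer_inf_mul_card_le (h : SubgroupTPP H₁ H₂ H₃) :
    Nat.card H₁ * Nat.card ↥(Subgroup.normalizer (H₁ : Set G) ⊓ H₂) * Nat.card H₃ ≤
      Nat.card G := by
  set N := Subgroup.normalizer (H₁ : Set G) ⊓ H₂ with hN
  let f : H₁ × N × H₃ → G := fun x => (x.1 : G) * (x.2.1 : G) * (x.2.2 : G)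
  have hf : Function.Injective f := by
    rintro ⟨⟨a, ha⟩, ⟨b, hb⟩, ⟨c, hc⟩⟩ ⟨⟨a', ha'⟩, ⟨b', hb'⟩, ⟨c', hc'⟩⟩ he
    simp only [f] at he
    -- `b'⁻¹ (a'⁻¹ a) b b'⁻¹ b' c c'⁻¹ = 1`, regrouped as `a'' · (b'⁻¹ b) · (c c'⁻¹) = 1`
    have hb'N : b' ∈ Subgroup.normalizer (H₁ : Set G) := (Subgroup.mem_inf.1 hb').1
    have hbH : b ∈ H₂ := (Subgroup.mem_inf.1 hb).2
    have hb'H : b' ∈ H₂ := (Subgroup.mem_inf.1 hb').2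
    set a'' := b'⁻¹ * (a'⁻¹ * a) * b' with ha''
    have ha''mem : a'' ∈ H₁ := by
      have hinv : b'⁻¹ ∈ Subgroup.normalizer (H₁ : Set G) := Subgroup.inv_mem _ hb'N
      have := (Subgroup.mem_normalizer_iff.1 hinv (a'⁻¹ * a)).1 (H₁.mul_mem (H₁.inv_mem ha') ha)
      simpa [ha'', mul_assoc] using this
    have hrel : a'' * (b'⁻¹ * b) * (c * c'⁻¹) = 1 := by
      rw [ha'']
      calc b'⁻¹ * (a'⁻¹ * a) * b' * (b'⁻¹ * b) * (c * c'⁻¹)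
          = b'⁻¹ * a'⁻¹ * (a * b * c) * c'⁻¹ := by group
        _ = b'⁻¹ * a'⁻¹ * (a' * b' * c') * c'⁻¹ := by rw [he]
        _ = 1 := by group
    obtain ⟨h1, h2, h3⟩ := h a'' ha''mem _ (H₂.mul_mem (H₂.inv_mem hb'H) hbH) _
      (H₃.mul_mem hc (H₃.inv_mem hc')) hrel
    have hbb : b = b' := by
      have := congrArg (b' * ·) h2
      simpa using this
    have hcc : c = c' := mul_inv_eq_one.1 h3
    have haa : a = a' := by
      have h1' : a'⁻¹ * a = 1 := by
        have := congrArg (fun x => b' * x * b'⁻¹) h1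
        simpa [ha'', mul_assoc] using this
      have := congrArg (a' * ·) h1'
      simpa using this
    subst hbb hcc haa
    rfl
  have := Nat.card_le_card_of_injective f hf
  simpa [Nat.card_prod, mul_assoc] using this

/-- Consequence: `|H₁| |H₂| |H₃| · |N(H₁)| ≤ |G|²` (BCGPU 2023, proof of Thm. 3.6:
`|G| ≥ |H₁| |N(H₁) ∩ H₂| |H₃| ≥ |H₁| · |N(H₁)||H₂|/|G| · |H₃|`).
[cite: BlasiakCohnGrochowPrattUmans2023, Thm. 3.6 (proof)] -/
theorem SubgroupTPP.prod_card_mul_card_normalizer_le (h : SubgroupTPP H₁ H₂ H₃) :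
    Nat.card H₁ * Nat.card H₂ * Nat.card H₃ * Nat.card ↥(Subgroup.normalizer (H₁ : Set G)) ≤
      Nat.card G ^ 2 := by
  have h1 := h.card_mul_card_normalizer_inf_mul_card_le
  have h2 := card_mul_card_le_card_inf_mul_card (Subgroup.normalizer (H₁ : Set G)) H₂
  calc Nat.card H₁ * Nat.card H₂ * Nat.card H₃ * Nat.card ↥(Subgroup.normalizer (H₁ : Set G))
      = Nat.card H₁ * Nat.card H₃ * (Nat.card ↥(Subgroup.normalizer (H₁ : Set G)) * Nat.card H₂) := by
        ring
    _ ≤ Nat.card H₁ * Nat.card H₃ *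
          (Nat.card ↥(Subgroup.normalizer (H₁ : Set G) ⊓ H₂) * Nat.card G) := by gcongr
    _ = (Nat.card H₁ * Nat.card ↥(Subgroup.normalizer (H₁ : Set G) ⊓ H₂) * Nat.card H₃) *
          Nat.card G := by ring
    _ ≤ Nat.card G * Nat.card G := by gcongr
    _ = Nat.card G ^ 2 := (sq _).symm

/-- **BCGPU 2023, Theorem 3.6, integral form**: for subgroups `H₁, H₂, H₃` with the triple product
property in a finite group,
`(|H₁||H₂||H₃|)³ · |N(H₁)| |N(H₂)| |N(H₃)| ≤ |G|⁶` — i.e. `|H₁||H₂||H₃| ≤ |G|^{3/2}/(s₁s₂s₃)^{1/4}`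
with `sᵢ = |N(Hᵢ)|/|Hᵢ|` (product of the previous inequality over the three cyclic shifts).
[cite: BlasiakCohnGrochowPrattUmans2023, Thm. 3.6] -/
theorem SubgroupTPP.normalizer_barrier_nat (h : SubgroupTPP H₁ H₂ H₃) :
    (Nat.card H₁ * Nat.card H₂ * Nat.card H₃) ^ 3 *
      (Nat.card ↥(Subgroup.normalizer (H₁ : Set G)) * Nat.card ↥(Subgroup.normalizer (H₂ : Set G)) *
        Nat.card ↥(Subgroup.normalizer (H₃ : Set G))) ≤ Nat.card G ^ 6 := by
  have e1 := h.prod_card_mul_card_normalizer_le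
  have e2 := h.rotate.prod_card_mul_card_normalizer_le
  have e3 := h.rotate.rotate.prod_card_mul_card_normalizer_le
  calc (Nat.card H₁ * Nat.card H₂ * Nat.card H₃) ^ 3 *
      (Nat.card ↥(Subgroup.normalizer (H₁ : Set G)) * Nat.card ↥(Subgroup.normalizer (H₂ : Set G)) *
        Nat.card ↥(Subgroup.normalizer (H₃ : Set G)))
      = (Nat.card H₁ * Nat.card H₂ * Nat.card H₃ * Nat.card ↥(Subgroup.normalizer (H₁ : Set G))) *
        (Nat.card H₂ * Nat.card H₃ * Nat.card H₁ * Nat.card ↥(Subgroup.normalizer (H₂ : Set G))) *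
        (Nat.card H₃ * Nat.card H₁ * Nat.card H₂ * Nat.card ↥(Subgroup.normalizer (H₃ : Set G))) := by
        ring
    _ ≤ Nat.card G ^ 2 * Nat.card G ^ 2 * Nat.card G ^ 2 := by gcongr
    _ = Nat.card G ^ 6 := by ring

/-- **BCGPU 2023, Theorem 3.6** (as printed: "Suppose that subgroups `H₁`, `H₂`, and `H₃` satisfy
the triple product property in a finite group `G`, and let `sᵢ = |N(Hᵢ)|/|Hᵢ|`. Then
`|H₁||H₂||H₃| ≤ |G|^{3/2}/(s₁s₂s₃)^{1/4}`."). PROVED (from the integral form).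
[cite: BlasiakCohnGrochowPrattUmans2023, Thm. 3.6] -/
theorem SubgroupTPP.normalizer_barrier (h : SubgroupTPP H₁ H₂ H₃) :
    ((Nat.card H₁ * Nat.card H₂ * Nat.card H₃ : ℕ) : ℝ) ≤
      (Nat.card G : ℝ) ^ (3 / 2 : ℝ) /
        (((Nat.card ↥(Subgroup.normalizer (H₁ : Set G)) : ℝ) / Nat.card H₁) *
          ((Nat.card ↥(Subgroup.normalizer (H₂ : Set G)) : ℝ) / Nat.card H₂) *
          ((Nat.card ↥(Subgroup.normalizer (H₃ : Set G)) : ℝ) / Nat.card H₃)) ^ (1 / 4 : ℝ) := by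
  -- abbreviations
  set P : ℕ := Nat.card H₁ * Nat.card H₂ * Nat.card H₃ with hP
  set N : ℕ := Nat.card ↥(Subgroup.normalizer (H₁ : Set G)) *
    Nat.card ↥(Subgroup.normalizer (H₂ : Set G)) * Nat.card ↥(Subgroup.normalizer (H₃ : Set G)) with hN
  have hnat : P ^ 3 * N ≤ Nat.card G ^ 6 := h.normalizer_barrier_nat
  have hP0 : (0 : ℝ) < P := by
    have : 0 < P := by
      rw [hP]; exact Nat.mul_pos (Nat.mul_pos Nat.card_pos Nat.card_pos) Nat.card_pos
    exact_mod_cast this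
  have hN0 : (0 : ℝ) < N := by
    have : 0 < N := by
      rw [hN]; exact Nat.mul_pos (Nat.mul_pos Nat.card_pos Nat.card_pos) Nat.card_pos
    exact_mod_cast this
  have hG0 : (0 : ℝ) < Nat.card G := by exact_mod_cast (Nat.card_pos (α := G))
  have h1 : (0:ℝ) < Nat.card H₁ := by exact_mod_cast (Nat.card_pos (α := H₁))
  have h2 : (0:ℝ) < Nat.card H₂ := by exact_mod_cast (Nat.card_pos (α := H₂))
  have h3 : (0:ℝ) < Nat.card H₃ := by exact_mod_cast (Nat.card_pos (α := H₃))
  -- the product `s₁ s₂ s₃ = N / P`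
  have hs : ((Nat.card ↥(Subgroup.normalizer (H₁ : Set G)) : ℝ) / Nat.card H₁) *
      ((Nat.card ↥(Subgroup.normalizer (H₂ : Set G)) : ℝ) / Nat.card H₂) *
      ((Nat.card ↥(Subgroup.normalizer (H₃ : Set G)) : ℝ) / Nat.card H₃) = (N : ℝ) / P := by
    rw [hN, hP]; push_cast
    field_simp
  rw [hs]
  have hsP : (0 : ℝ) < (N : ℝ) / P := div_pos hN0 hP0
  rw [le_div_iff₀ (Real.rpow_pos_of_pos hsP _)]
  -- compare fourth powers
  have key : ((P : ℝ) * ((N : ℝ) / P) ^ (1 / 4 : ℝ)) ^ (4 : ℕ) ≤ ((Nat.card G : ℝ) ^ (3 / 2 : ℝ)) ^ (4 : ℕ) := by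
    have lhs : ((P : ℝ) * ((N : ℝ) / P) ^ (1 / 4 : ℝ)) ^ (4 : ℕ) = (P : ℝ) ^ 3 * N := by
      rw [mul_pow, ← Real.rpow_natCast (((N : ℝ) / P) ^ (1 / 4 : ℝ)) 4, ← Real.rpow_mul hsP.le]
      have h14 : (1 / 4 : ℝ) * ((4 : ℕ) : ℝ) = 1 := by norm_num
      rw [h14, Real.rpow_one]
      field_simp
    have rhs : ((Nat.card G : ℝ) ^ (3 / 2 : ℝ)) ^ (4 : ℕ) = (Nat.card G : ℝ) ^ (6 : ℕ) := by
      rw [← Real.rpow_natCast ((Nat.card G : ℝ) ^ (3 / 2 : ℝ)) 4, ← Real.rpow_mul hG0.le]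
      norm_num
    rw [lhs, rhs]
    exact_mod_cast hnat
  have hpos : 0 ≤ (Nat.card G : ℝ) ^ (3 / 2 : ℝ) := Real.rpow_nonneg hG0.le _
  have := le_of_pow_le_pow_left₀ (by norm_num : (4 : ℕ) ≠ 0) hpos key
  simpa [hP] using this

/-! ## Corollary 3.8: a large center -/

/-- For a subgroup `H` of a finite group, `|H| · |Z(G)| ≤ |N(H)| · |H ∩ Z(G)|` (BCGPU 2023, proof
of Cor. 3.8: `|H Z(G)| = |H||Z(G)|/|H ∩ Z(G)|` and `H Z(G) ⊆ N(H)`); here from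
`[N : H ∩ Z] ≤ [N : H][N : Z]` inside `N = N(H)` (Mathlib `Subgroup.relIndex_inf_le`).
[cite: BlasiakCohnGrochowPrattUmans2023, Cor. 3.8 (proof)] -/
theorem card_mul_card_center_le (H : Subgroup G) :
    Nat.card H * Nat.card ↥(Subgroup.center G) ≤
      Nat.card ↥(Subgroup.normalizer (H : Set G)) * Nat.card ↥(H ⊓ Subgroup.center G) := by
  set N := Subgroup.normalizer (H : Set G) with hN
  set Z := Subgroup.center G with hZ
  have hHN : H ≤ N := Subgroup.le_normalizer
  have hZN : Z ≤ N := Subgroup.center_le_normalizer (H : Set G)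
  have hIN : H ⊓ Z ≤ N := inf_le_left.trans hHN
  have hi : (H ⊓ Z).relIndex N ≤ H.relIndex N * Z.relIndex N := Subgroup.relIndex_inf_le
  -- `K.relIndex N * |K| = |N|` for `K ≤ N`
  have card_mul : ∀ K : Subgroup G, K ≤ N → K.relIndex N * Nat.card K = Nat.card N := by
    intro K hK
    have e1 : K.relIndex N * N.index = K.index := Subgroup.relIndex_mul_index hK
    have e2 := K.card_mul_index
    have e3 := N.card_mul_index
    have hNi : 0 < N.index := Nat.pos_of_ne_zero Subgroup.index_ne_zero_of_finite
    refine Nat.eq_of_mul_eq_mul_right hNi ?_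
    calc K.relIndex N * Nat.card K * N.index = Nat.card K * (K.relIndex N * N.index) := by ring
      _ = Nat.card G := by rw [e1, e2]
      _ = Nat.card N * N.index := e3.symm
  have eI := card_mul (H ⊓ Z) hIN
  have eH := card_mul H hHN
  have eZ := card_mul Z hZN
  have hNpos : 0 < Nat.card N := Nat.card_pos
  -- multiply `hi` by `|H ∩ Z| |H| |Z|` and cancel `|N|`
  refine Nat.le_of_mul_le_mul_left ?_ hNpos
  calc Nat.card N * (Nat.card H * Nat.card Z)
      = ((H ⊓ Z).relIndex N * Nat.card ↥(H ⊓ Z)) * (Nat.card H * Nat.card Z) := by rw [eI]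
    _ ≤ (H.relIndex N * Z.relIndex N * Nat.card ↥(H ⊓ Z)) * (Nat.card H * Nat.card Z) := by gcongr
    _ = (H.relIndex N * Nat.card H) * (Z.relIndex N * Nat.card Z) * Nat.card ↥(H ⊓ Z) := by ring
    _ = Nat.card N * (Nat.card N * Nat.card ↥(H ⊓ Z)) := by rw [eH, eZ]; ring

/-- Cohn–Umans' abelian bound inside the center: if `H₁, H₂, H₃` satisfy the subgroup TPP then
`|H₁ ∩ Z(G)| |H₂ ∩ Z(G)| |H₃ ∩ Z(G)| ≤ |Z(G)|` (the product map is injective on central elements;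
BCGPU 2023, proof of Cor. 3.8, citing Cohn–Umans 2003, Lemma 3.1).
[cite: BlasiakCohnGrochowPrattUmans2023, Cor. 3.8 (proof)] -/
theorem SubgroupTPP.prod_card_inf_center_le (h : SubgroupTPP H₁ H₂ H₃) :
    Nat.card ↥(H₁ ⊓ Subgroup.center G) * Nat.card ↥(H₂ ⊓ Subgroup.center G) *
      Nat.card ↥(H₃ ⊓ Subgroup.center G) ≤ Nat.card ↥(Subgroup.center G) := by
  set Z := Subgroup.center G with hZ
  let f : ↥(H₁ ⊓ Z) × ↥(H₂ ⊓ Z) × ↥(H₃ ⊓ Z) → Z := fun x =>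
    ⟨(x.1 : G) * (x.2.1 : G) * (x.2.2 : G),
      Z.mul_mem (Z.mul_mem (Subgroup.mem_inf.1 x.1.2).2 (Subgroup.mem_inf.1 x.2.1.2).2)
        (Subgroup.mem_inf.1 x.2.2.2).2⟩
  have hf : Function.Injective f := by
    rintro ⟨⟨a, ha⟩, ⟨b, hb⟩, ⟨c, hc⟩⟩ ⟨⟨a', ha'⟩, ⟨b', hb'⟩, ⟨c', hc'⟩⟩ he
    simp only [f, Subtype.mk.injEq] at he
    obtain ⟨haH, haZ⟩ := Subgroup.mem_inf.1 ha
    obtain ⟨ha'H, ha'Z⟩ := Subgroup.mem_inf.1 ha'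
    obtain ⟨hbH, hbZ⟩ := Subgroup.mem_inf.1 hb
    obtain ⟨hb'H, hb'Z⟩ := Subgroup.mem_inf.1 hb'
    obtain ⟨hcH, hcZ⟩ := Subgroup.mem_inf.1 hc
    obtain ⟨hc'H, hc'Z⟩ := Subgroup.mem_inf.1 hc'
    -- everything commutes: `(a'⁻¹a)(b'⁻¹b)(c c'⁻¹) = 1`
    have hbc : b'⁻¹ ∈ Z := Z.inv_mem hb'Z
    have hrel : (a'⁻¹ * a) * (b'⁻¹ * b) * (c * c'⁻¹) = 1 := by
      have hza := Subgroup.mem_center_iff.1 ha'Z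
      have hzb' := Subgroup.mem_center_iff.1 hbc
      have hzb := Subgroup.mem_center_iff.1 hbZ
      calc a'⁻¹ * a * (b'⁻¹ * b) * (c * c'⁻¹)
          = a'⁻¹ * (a * b'⁻¹) * (b * c) * c'⁻¹ := by group
        _ = a'⁻¹ * (b'⁻¹ * a) * (b * c) * c'⁻¹ := by rw [hzb' a]
        _ = a'⁻¹ * b'⁻¹ * (a * b * c) * c'⁻¹ := by group
        _ = a'⁻¹ * b'⁻¹ * (a' * b' * c') * c'⁻¹ := by rw [he]
        _ = a'⁻¹ * (b'⁻¹ * a') * b' * (c' * c'⁻¹) := by group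
        _ = a'⁻¹ * (a' * b'⁻¹) * b' * (c' * c'⁻¹) := by rw [← hzb' a']
        _ = 1 := by group
    obtain ⟨h1, h2, h3⟩ := h _ (H₁.mul_mem (H₁.inv_mem ha'H) haH) _
      (H₂.mul_mem (H₂.inv_mem hb'H) hbH) _ (H₃.mul_mem hcH (H₃.inv_mem hc'H)) hrel
    have haa : a = a' := by have := congrArg (a' * ·) h1; simpa using this
    have hbb : b = b' := by have := congrArg (b' * ·) h2; simpa using this
    have hcc : c = c' := mul_inv_eq_one.1 h3
    subst haa hbb hcc; rfl
  have := Nat.card_le_card_of_injective f hf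
  simpa [Nat.card_prod, mul_assoc] using this

/-- **BCGPU 2023, Corollary 3.8, integral form**: `(|H₁||H₂||H₃|)² · |Z(G)| ≤ |G|³` for subgroups
with the triple product property. [cite: BlasiakCohnGrochowPrattUmans2023, Cor. 3.8] -/
theorem SubgroupTPP.center_barrier_nat (h : SubgroupTPP H₁ H₂ H₃) :
    (Nat.card H₁ * Nat.card H₂ * Nat.card H₃) ^ 2 * Nat.card ↥(Subgroup.center G) ≤
      Nat.card G ^ 3 := by
  set Z := Subgroup.center G with hZ
  set P := Nat.card H₁ * Nat.card H₂ * Nat.card H₃ with hP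
  set N := Nat.card ↥(Subgroup.normalizer (H₁ : Set G)) *
    Nat.card ↥(Subgroup.normalizer (H₂ : Set G)) * Nat.card ↥(Subgroup.normalizer (H₃ : Set G))
    with hN
  have hZpos : 0 < Nat.card Z := Nat.card_pos
  -- `P · |Z|² ≤ N`
  have c1 := card_mul_card_center_le H₁
  have c2 := card_mul_card_center_le H₂
  have c3 := card_mul_card_center_le H₃
  have hPZ : P * Nat.card Z ^ 2 ≤ N := by
    refine Nat.le_of_mul_le_mul_left ?_ hZpos
    calc Nat.card Z * (P * Nat.card Z ^ 2)
        = (Nat.card H₁ * Nat.card Z) * (Nat.card H₂ * Nat.card Z) * (Nat.card H₃ * Nat.card Z) := by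
          rw [hP]; ring
      _ ≤ (Nat.card ↥(Subgroup.normalizer (H₁ : Set G)) * Nat.card ↥(H₁ ⊓ Z)) *
          (Nat.card ↥(Subgroup.normalizer (H₂ : Set G)) * Nat.card ↥(H₂ ⊓ Z)) *
          (Nat.card ↥(Subgroup.normalizer (H₃ : Set G)) * Nat.card ↥(H₃ ⊓ Z)) := by gcongr
      _ = N * (Nat.card ↥(H₁ ⊓ Z) * Nat.card ↥(H₂ ⊓ Z) * Nat.card ↥(H₃ ⊓ Z)) := by rw [hN]; ring
      _ ≤ N * Nat.card Z := by gcongr; exact h.prod_card_inf_center_le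
      _ = Nat.card Z * N := mul_comm _ _
  -- combine with Thm. 3.6: `P⁴ |Z|² ≤ P³ N ≤ |G|⁶`
  have h36 : P ^ 3 * N ≤ Nat.card G ^ 6 := h.normalizer_barrier_nat
  have h4 : (P ^ 2 * Nat.card Z) ^ 2 ≤ (Nat.card G ^ 3) ^ 2 := by
    calc (P ^ 2 * Nat.card Z) ^ 2 = P ^ 3 * (P * Nat.card Z ^ 2) := by ring
      _ ≤ P ^ 3 * N := by gcongr
      _ ≤ Nat.card G ^ 6 := h36
      _ = (Nat.card G ^ 3) ^ 2 := by ring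
  exact (Nat.pow_le_pow_iff_left (by norm_num)).1 h4

/-- **BCGPU 2023, Corollary 3.8** (as printed: "If subgroups `H₁`, `H₂`, and `H₃` satisfy the
triple product property in a finite group `G`, then `|H₁||H₂||H₃| ≤ |G|^{3/2}/|Z(G)|^{1/2}`.").
PROVED. Consequently subgroup TPP constructions in groups with `|Z(G)| = Ω(|G|^δ)`, e.g. in
`GL(n,q)` with `n` fixed, cannot meet the packing bound `|H₁||H₂||H₃| = |G|^{3/2−o(1)}`.
[cite: BlasiakCohnGrochowPrattUmans2023, Cor. 3.8] -/
theorem SubgroupTPP.center_barrier (h : SubgroupTPP H₁ H₂ H₃) :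
    ((Nat.card H₁ * Nat.card H₂ * Nat.card H₃ : ℕ) : ℝ) ≤
      (Nat.card G : ℝ) ^ (3 / 2 : ℝ) / Real.sqrt (Nat.card ↥(Subgroup.center G)) := by
  have hnat := h.center_barrier_nat
  set P := Nat.card H₁ * Nat.card H₂ * Nat.card H₃ with hP
  have hZ0 : (0 : ℝ) < Nat.card ↥(Subgroup.center G) := by
    exact_mod_cast (Nat.card_pos (α := ↥(Subgroup.center G)))
  have hG0 : (0 : ℝ) < Nat.card G := by exact_mod_cast (Nat.card_pos (α := G))
  rw [le_div_iff₀ (Real.sqrt_pos.2 hZ0)]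
  have key : ((P : ℝ) * Real.sqrt (Nat.card ↥(Subgroup.center G))) ^ (2 : ℕ) ≤
      ((Nat.card G : ℝ) ^ (3 / 2 : ℝ)) ^ (2 : ℕ) := by
    rw [mul_pow, Real.sq_sqrt hZ0.le, ← Real.rpow_natCast ((Nat.card G : ℝ) ^ (3 / 2 : ℝ)) 2,
      ← Real.rpow_mul hG0.le]
    norm_num
    exact_mod_cast hnat
  exact le_of_pow_le_pow_left₀ (by norm_num : (2 : ℕ) ≠ 0) (Real.rpow_nonneg hG0.le _) key

/-- The packing-bound reading of Cor. 3.8 (BCGPU 2023, before Cor. 3.8: "triple product property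
constructions using subgroups of groups `G` satisfying `|Z(G)| = Ω(|G|^δ)` with `δ > 0` cannot meet
the packing bound. For example, … triples of subgroups in `GL(n,q)` with fixed `n`"): if
`|Z(G)| ≥ |G|^δ` then `|H₁||H₂||H₃| ≤ |G|^{3/2 − δ/2}`.
[cite: BlasiakCohnGrochowPrattUmans2023, Cor. 3.8] -/
theorem SubgroupTPP.center_barrier_rpow (h : SubgroupTPP H₁ H₂ H₃) {δ : ℝ}
    (hZ : (Nat.card G : ℝ) ^ δ ≤ Nat.card ↥(Subgroup.center G)) :
    ((Nat.card H₁ * Nat.card H₂ * Nat.card H₃ : ℕ) : ℝ) ≤ (Nat.card G : ℝ) ^ (3 / 2 - δ / 2 : ℝ) := by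
  have hG0 : (0 : ℝ) < Nat.card G := by exact_mod_cast (Nat.card_pos (α := G))
  have hZδ : (0 : ℝ) < (Nat.card G : ℝ) ^ δ := Real.rpow_pos_of_pos hG0 δ
  refine h.center_barrier.trans ?_
  calc (Nat.card G : ℝ) ^ (3 / 2 : ℝ) / Real.sqrt (Nat.card ↥(Subgroup.center G))
      ≤ (Nat.card G : ℝ) ^ (3 / 2 : ℝ) / Real.sqrt ((Nat.card G : ℝ) ^ δ) := by
        gcongr
    _ = (Nat.card G : ℝ) ^ (3 / 2 - δ / 2 : ℝ) := by
        rw [Real.sqrt_eq_rpow, ← Real.rpow_mul hG0.le, div_eq_iff (Real.rpow_pos_of_pos hG0 _).ne',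
          ← Real.rpow_add hG0]
        ring_nf

end Counting

/-! ## Subsets: only coset fibres over the centre are charged (audit note to Rem. 3.7 / Cor. 3.8) -/

section SubsetCentre

open Literature.Combinatorics.Additive

variable [Fintype G]

/-- **What survives of the centre step of Cor. 3.8 for arbitrary subsets.** If finite sets
`S, T, U ⊆ G` satisfy the triple product property (Cohn–Umans 2003, Def. 2.1, right quotients —
the tree's `TripleProductProperty`) and `C ⊆ U` lies in a single coset of the centre (all quotients
`z z'⁻¹`, `z, z' ∈ C`, are central), then `(s, t, z) ↦ s⁻¹ t z` is injective on `S × T × C`, so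
`|S| · |T| · |C| ≤ |G|`: from `s⁻¹tz = s'⁻¹t'z'` one gets `(s's⁻¹)(tt'⁻¹)(zz'⁻¹) = 1` because `zz'⁻¹`
is central. For subgroups, Cor. 3.8 charges the centre through `|Z(G)| ≥ ∏ |Hᵢ ∩ Z(G)|` and
`|Hᵢ Z(G)| ≤ |N(Hᵢ)|`; for subsets this coset-fibre count is all that remains of it (BCGPU 2023,
Rem. 3.7 gives the same, since `Z(G) ⊆ N(Q(S))`
[cite: BlasiakCohnGrochowPrattUmans2023, Rem. 3.7 and footnote to Cor. 3.8]): a set meeting every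
coset of `Z(G)` in `O(1)` points is charged only `O(|S| |T|) = O(|G|)` by it, which is why Cor. 3.8
is a statement about SUBGROUPS and why the paper treats arbitrary subsets of `GL(n,q)` through the
Lie-type barrier instead (footnote to Cor. 3.8) — scope caveat (f) of the catalogue block.
[folklore] -/
theorem tpp_card_mul_card_mul_card_coset_center_le {S T U C : Finset G}
    (h : TripleProductProperty S T U) (hCU : C ⊆ U)
    (hC : ∀ z ∈ C, ∀ z' ∈ C, z * z'⁻¹ ∈ Subgroup.center G) :
    S.card * T.card * C.card ≤ Fintype.card G := by
  let f : S × T × C → G := fun x => (x.1 : G)⁻¹ * (x.2.1 : G) * (x.2.2 : G)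
  have hf : Function.Injective f := by
    rintro ⟨⟨s, hs⟩, ⟨t, ht⟩, ⟨z, hz⟩⟩ ⟨⟨s', hs'⟩, ⟨t', ht'⟩, ⟨z', hz'⟩⟩ he
    simp only [f] at he
    -- `he : s⁻¹ t z = s'⁻¹ t' z'`, i.e. `s' s⁻¹ t z = t' z'`
    have h1 : s' * s⁻¹ * t * z = t' * z' := by
      have := congrArg (s' * ·) he
      simpa [mul_assoc] using this
    have hzzc := Subgroup.mem_center_iff.1 (hC z hz z' hz')
    -- move the central quotient `z z'⁻¹` past `t'⁻¹`
    have hrel : s' * s⁻¹ * (t * t'⁻¹) * (z * z'⁻¹) = 1 := by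
      calc s' * s⁻¹ * (t * t'⁻¹) * (z * z'⁻¹)
          = s' * s⁻¹ * t * (t'⁻¹ * (z * z'⁻¹)) := by group
        _ = s' * s⁻¹ * t * ((z * z'⁻¹) * t'⁻¹) := by rw [hzzc t'⁻¹]
        _ = (s' * s⁻¹ * t * z) * z'⁻¹ * t'⁻¹ := by group
        _ = (t' * z') * z'⁻¹ * t'⁻¹ := by rw [h1]
        _ = 1 := by group
    obtain ⟨hss, htt, hzz⟩ := h s' hs' s hs t ht t' ht' z (hCU hz) z' (hCU hz') hrel
    subst hss htt hzz
    rfl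
  have := Fintype.card_le_of_injective f hf
  simpa [Fintype.card_prod, Fintype.card_coe, mul_assoc] using this

/-- The central fibre itself: if `C ⊆ U ∩ Z(G)` then `|S| · |T| · |C| ≤ |G|` (the case `g = 1` of
the previous bound; for subgroups `Hᵢ` this is `|H₁| |H₂| |H₃ ∩ Z(G)| ≤ |G|`). [folklore] -/
theorem tpp_card_mul_card_mul_card_center_le {S T U C : Finset G}
    (h : TripleProductProperty S T U) (hCU : C ⊆ U) (hC : ∀ z ∈ C, z ∈ Subgroup.center G) :
    S.card * T.card * C.card ≤ Fintype.card G :=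
  tpp_card_mul_card_mul_card_coset_center_le h hCU fun z hz z' hz' =>
    (Subgroup.center G).mul_mem (hC z hz) ((Subgroup.center G).inv_mem (hC z' hz'))

end SubsetCentre

/-! ## Catalogue entry (D-0021) -/

section Catalogue

/-- **Subgroup TPP constructions need nearly self-normalizing subgroups and a small center
(Blasiak–Cohn–Grochow–Pratt–Umans 2023, Thm. 3.6 and Cor. 3.8).** The catalogue entry is the
conjunction of the two integral inequalities, over all finite groups (in `Type`) and all triples of
subgroups with the triple product property; PROVED below (`normalizerBarrier_holds`).

BARRIER
technique_class: group-theoretic-approach, Cohn–Umans, triple-product-property via three SUBGROUPS `H₁, H₂, H₃ ≤ G` (`SubgroupTPP`), matrix groups `GL(n,q)` / groups with a large center, subgroups with large normalisers `sᵢ = |N(Hᵢ)|/|Hᵢ|`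
blocks: meeting the packing bound `|H₁||H₂||H₃| = |G|^{3/2−o(1)}` (BCGPU Def. 2.3) — necessary for `ω = 2` via the Cohn–Umans inequality `(|S||T||U|)^{ω/3} ≤ ∑ dᵢ^ω` ("Meeting the packing bound is a necessary condition for Theorem 2.2 to yield `ω = 2`: if a family of groups contains no sequence meeting the packing bound, then there is a constant `ε > 0` such that no group in the family can prove an upper bound on `ω` better than `2 + ε`") [cite: BlasiakCohnGrochowPrattUmans2023, §2 (Def. 2.3 and following paragraph)] — with three subgroups whose normalisers are large: `|H₁||H₂||H₃| ≤ |G|^{3/2}/(s₁s₂s₃)^{1/4}` (`SubgroupTPP.normalizer_barrier`) [cite: BlasiakCohnGrochowPrattUmans2023, Thm. 3.6], in particular `|H₁||H₂||H₃| ≤ |G|^{3/2}/|Z(G)|^{1/2}` (`SubgroupTPP.center_barrier`), so "triple product property constructions using subgroups of groups `G` satisfying `|Z(G)| = Ω(|G|^δ)` with `δ > 0` cannot meet the packing bound. For example, this shows that triples of subgroups in `GL(n,q)` with fixed `n` cannot meet the packing bound" (`SubgroupTPP.center_barrier_rpow`: `≤ |G|^{3/2−δ/2}`) [cite: BlasiakCohnGrochowPrattUmans2023,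 Cor. 3.8]; this constrains the route item `CNonabelianTPPFamilies` of `MatrixMultiplication/GroupTheoreticSTPP` when realised by subgroups.
because: `(h₁,h₂,h₃) ↦ h₁h₂h₃` is injective on `H₁ × (N(H₁) ∩ H₂) × H₃` (conjugating `h₁'⁻¹h₁` by `h₂' ∈ N(H₁)` stays in `H₁`, then the TPP), so `|G| ≥ |H₁||N(H₁) ∩ H₂||H₃| ≥ |H₁| |N(H₁)||H₂|/|G| |H₃|`; multiply the three cyclic versions [cite: BlasiakCohnGrochowPrattUmans2023, Thm. 3.6 (proof)]; for the center, `Hᵢ ∩ Z(G)` satisfy the TPP in the abelian group `Z(G)`, so `|Z(G)| ≥ ∏|Hᵢ ∩ Z(G)|` (Cohn–Umans 2003, Lemma 3.1) and `|HᵢZ(G)| ≤ |N(Hᵢ)|` give `s₁s₂s₃ ≥ |Z(G)|²` [cite: BlasiakCohnGrochowPrattUmans2023, Cor. 3.8 (proof)].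
evasions_known: self-normalizing subgroups: "our normalizer barrier suggests that constructions should aim to use subgroups that are self-normalizing"; in the continuous setting three conjugates of `O(n,ℝ)` in `GL(n,ℝ)` satisfy a (`K`-)triple product property, meet the packing bound and evade the normalizer barrier "since the normalizer of `O(n,ℝ)` in `GL(n,ℝ)` is `ℝ^× · O(n,ℝ)`" [cite: BlasiakCohnGrochowPrattUmans2023, §1.1 (p. 4) and Thm. 4.10]; arbitrary subsets instead of subgroups fall under the weaker Rem. 3.7 only [cite: BlasiakCohnGrochowPrattUmans2023, Rem. 3.7]; no finite construction in groups of Lie type meeting the packing bound is known ("This remains an important challenge") [cite: BlasiakCohnGrochowPrattUmans2023, §1.1 (p. 4)]; (audit 2026-08-15, additions:) (iv) FINITE subgroup triples that MEET the packing bound exist and evade the barrier exactly as it predicts, by (near-)self-normalisation in groups with tiny centre — the Young subgroups of the rows / columns / diagonals of a triangular array in `S_{n(n+1)/2}` (`α ≤ 2 + (2 − log 2)/log n`; block sizes `1, 2, …, n` are distinct, so `N(Hᵢ) = Hᵢ`, and `Z = 1`) [cite: CohnUmans2003, Thm. 3.3 (Thm. 6 of the arXiv text, p. 5)] and the three conjugate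 copies of `Sₙ` (graphs of coboundaries) in the wreath product `Cyc_{2n} ≀ Sₙ` (`α ≤ 2 + (1 + log 2)/log n`; `N(Hᵢ) = Hᵢ · Δ(Cyc_{2n})`, so `sᵢ = |Z(G)| = 2n = |G|^{o(1)}`) — the finite counterpart of the "three conjugates of `O(n,ℝ)`" [cite: CohnUmans2003, §7, wreath products (Thm. 17 of the arXiv text, pp. 9–10)]; both are stopped for `ω = 2` by character degrees (`YoungSubgroupBarrier.lean`; `γ → 2`), not by this barrier; (v) the finiteness of `G` is essential: finite TPP subsets of INFINITE groups give bounds on `ω` through separating families of finite-dimensional representations, `(|X||Y||Z|)^{ω/3} ≤ ∑_{ρ ∈ R_sep} (dim ρ)^ω`, where no `|G|`-counting (packing bound, normalisers, centre) exists [cite: BlasiakCohnGrochowPrattUmans2025, Thm. 2.2 (Thm. A)]; (vi) consistent refinements for SUBGROUP triples only: one normal member already forces `|H₁||H₂||H₃| ≤ |G|` (immediate from the main observation with `N(H₁) ∩ H₂ = H₂`; in print as Hedtke–Murthy's Fact 3, together with the normal-core bound `|H₁||H₂||H₃| ≤ |H₁| · |G|/|Core_G(H₁)|`) [cite: Hedtke2011,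 §1 Fact 3 and §2], so the exponent `1/4` of Thm. 3.6 is far from sharp at that end; S. R. Murthy's note arXiv:2512.16730 (Thm. 4.1: `ρ₀(G) ≤ p²/(2p−1)` when `G` has an abelian normal subgroup of prime index `p`; kernel: `Murthy2025_thm41` in `Literature/Computability/AlgebraicComplexity/SubgroupTPPAbelianPrimeIndex.lean`) bounds the subgroup TPP capacity in a further small-quotient family, and the one-normal-member refinement above is kernel (`Murthy2026_prop26_2_subgroup` in `Literature/Computability/AlgebraicComplexity/SubgroupTPPQuotient.lean`) and the normal-core bound is `Hedtke2011_coreBound'` in `Literature/Computability/AlgebraicComplexity/SubgroupTPPCoreBound.lean` [cite: Murthy2025TPPIndexP, Thm. 4.1]; (update 2026-08-23:) the class-2 bounds announced in arXiv:2602.15796 v1 (Thm. 3.1 `ρ₀(G) < √|G:Z(G)|`; Thm. 4.1 / Cor. 4.2 `ρ₀ ≤ p` for `p`-groups with cyclic `G'` of order `p`, e.g. extraspecial groups; Thms. 5.1 / 6.1) are NOT counted here as established: the printed proofs of its Thm. 4.1 and Thm. 5.1 invoke its Lemma 2.18 and Prop. 2.17 (2), both of which are false (kernel: `Murthy2026_lemma218_false`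 in `Literature/GroupTheory/SpecificGroups/HeisenbergAxisSubgroups.lean`, `Murthy2026_prop217_2_false` in `Literature/GroupTheory/SpecificGroups/SpecialClassTwoP6.lean`), and the case (i.b) step of its Thm. 3.1 is unsubstantiated in print [cite: Murthy2026, Lemma 2.18, Prop. 2.17 and Thms. 3.1, 4.1, 5.1].
scope_caveats: (a) Thm. 3.6 / Cor. 3.8 concern three SUBGROUPS; for subsets `S,T,U` only the form `|S||T||U| ≤ (|G|³/(|N(Q(S)) ∩ T| |N(Q(T)) ∩ U| |N(Q(U)) ∩ S|))^{1/2}` is printed (Rem. 3.7; formalised 2026-08-23 in the companion `NormalizerBarrierSubsets.lean`: `BCGPU2023_rem37_sq` — `(|S||T||U|)²·|N(Q(S)) ∩ T|·|N(Q(T)) ∩ U|·|N(Q(U)) ∩ S| ≤ |G|³` for every TPP triple of subsets — and `BCGPU2023_rem37`, the printed square-root form), and the footnote's extension of the `GL(n,q)` example to arbitrary subsets is argued via random translates and the Lie-type barrier, not by Thm. 3.6 [cite: BlasiakCohnGrochowPrattUmans2023, Rem. 3.7 and footnote to Cor. 3.8]; (b) the statements bound `|H₁||H₂||H₃|` only;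 the step "no packing bound ⇒ no `ω = 2`" is the cited necessity paragraph of §2 (for simultaneous/STPP constructions see BCCGNSU Lemma 2.4), and a TPP construction failing the packing bound can still prove `ω < 3` [cite: BlasiakCohnGrochowPrattUmans2023, §2]; (c) nothing is said about STPP (simultaneous) constructions or about subgroups with `sᵢ = |G|^{o(1)}`; (audit 2026-08-15, additions:) (d) Rem. 3.7's "same proof" for subsets needs the map `(s,t,u) ↦ s⁻¹tu` (right-quotient convention of Def. 2.1) together with the permutation invariance of the TPP (Cohn–Umans 2003, §2); the printed inequality is correct as stated and is so proved in `NormalizerBarrierSubsets.lean` (`tpp_card_mul_card_normalizer_quot_mul_card_le`: `|S|·|N(Q(U)) ∩ T|·|U| ≤ |G|`; `TripleProductProperty.reverse` / `.swap₁₂` / `.swap₂₃`) [cite: BlasiakCohnGrochowPrattUmans2023, Rem. 3.7]; (e) `GL(n,q)` is blocked only for FIXED `n` (`|Z| = q − 1 ≍ |G|^{1/n²}`): for `n → ∞`, for `q = 2`, and for powers `GL(n,2)^k = SL(n,2)^k` the centre is `|G|^{o(1)}` or trivial and Cor. 3.8 is void (powers of a fixed group fall under Sawin 2018 / `NilpotentGroupBarrier.lean`,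 Lie type of any rank under Cor. 3.4 / `QuasirandomBarrier.lean`) [cite: BlasiakCohnGrochowPrattUmans2023, Cor. 3.8 and Cor. 3.4]; (f) the restriction to SUBGROUPS is load-bearing, not cosmetic: for subsets only one coset fibre of each set over `Z(G)` is charged (`tpp_card_mul_card_mul_card_coset_center_le`: `|S||T||U ∩ Z(G)g| ≤ |G|`), so for sets transverse to the centre the elementary count gives only `|S||T||U| ≤ |G/Z(G)|³`, which bites iff `|Z(G)| ≥ |G|^{1/2+ε}`; and in any family with `|Z(G)| ≥ |G|^δ`, `δ > 0`, every character degree satisfies `χ(1)² ≤ |G : Z(G)| ≤ |G|^{1−δ}`, i.e. `γ ≥ 2/(1−δ) > 2` in the notation of Cohn–Umans 2003, so a packing-bound family of SUBSET triples there would give `ω = 2` outright by `ω ≤ α(γ−2)/(γ−α)` ("an upper bound of `|G|^{1/2−ε}` for fixed `ε > 0` would be sufficient to obtain `ω = 2` from a family of groups with pseudo-exponent approaching 2") [cite: CohnUmans2003, §4 (Cor. 8 of the arXiv text, p. 6)] — this subset case is closed in print only for `GL(n,q)`, `n` fixed (footnote, via Lie type), for powers of a fixed group (Sawin 2018) and for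 bounded-exponent nilpotent hosts (BCCGU 2017, Cor. 3.20), and we found no bound for it in print otherwise (e.g. `ℤ/N × K`, central products with a growing cyclic centre; the Sperner-capacity quotient sets of Cohn–Umans 2003, §7 show that subsets can beat every subgroup triple: `α(D₄^k) < α(D₄) = 3`) [cite: BlasiakCohnGrochowPrattUmans2023, footnote to Cor. 3.8] [cite: CohnUmans2003, §7, direct products and the Sperner capacity (Prop. 18–19, Cor. 20 of the arXiv text, p. 10)].
status: theorem (established; proved in this file) [cite: BlasiakCohnGrochowPrattUmans2023, Thm. 3.6 and Cor. 3.8] -/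
def NormalizerBarrier : Prop :=
  ∀ (G : Type) [Group G] [Finite G] (H₁ H₂ H₃ : Subgroup G), SubgroupTPP H₁ H₂ H₃ →
    (Nat.card H₁ * Nat.card H₂ * Nat.card H₃) ^ 3 *
        (Nat.card ↥(Subgroup.normalizer (H₁ : Set G)) *
          Nat.card ↥(Subgroup.normalizer (H₂ : Set G)) *
          Nat.card ↥(Subgroup.normalizer (H₃ : Set G))) ≤ Nat.card G ^ 6 ∧
      (Nat.card H₁ * Nat.card H₂ * Nat.card H₃) ^ 2 * Nat.card ↥(Subgroup.center G) ≤
        Nat.card G ^ 3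

/-- **The normalizer barrier holds** (BCGPU 2023, Thm. 3.6 and Cor. 3.8, proved above).
[cite: BlasiakCohnGrochowPrattUmans2023, Thm. 3.6 and Cor. 3.8] -/
theorem normalizerBarrier_holds : NormalizerBarrier :=
  fun _ _ _ _ _ _ h => ⟨h.normalizer_barrier_nat, h.center_barrier_nat⟩

end Catalogue

end Literature.Barriers.MatrixMultiplication
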